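import Literature.Computability.MetaComplexity.GFDesignFP
import Literature.Computability.Learning.NWDesignFP
import HarnessLib

/-!
# The `AC⁰[p]` learner's design layer as string functions

Machine-layer groundwork for the named fact `Literature.Computability.Learning.cikk_learn_AC0Mod`
(CIKK 2016, Cor. 5.4): the learner of CIKK Thm. 5.1 for `AC⁰[p]` uses the `AC⁰[p]`-computable NW
design `designC p t` over `𝔽_p[X]/(P)` (`GFDesignConcrete.lean`) instead of the prime-field design of
`NWDesignFP.lean`, and must recompute its positions. This file packages the polynomial-time column
program of `GFDesignList.lean` / `GFDesignFP.lean` as plain string functions on the SAME record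
layout `X = ⟨pad, ⟨1^Q, ⟨1^ℓ, ⟨vbits, zbits⟩⟩⟩⟩` as `NWDesignFP.designCtx` (now `Q = pᵗ`), so that
the table / predictor / query machinery written for that layout can be re-instantiated:

* `Modp.colFn p` — `⟨X, 1^τ⟩ ↦ bin (colValL 𝔭 Q ℓ vbits τ)` (`colFn_apply` on every record);
* `Modp.posFn p` — `⟨X, 1^τ⟩ ↦ 1^{colValL … + Q·τ}` (`posFn_apply`);
* `Modp.restrictFn p` — `⟨X, 1^{n'}⟩ ↦` the `n'` bits `zbits[pos(v, τ)]`, `τ < n'`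
  (`restrictFn_apply`), and **`restrictFn_eq_ofFn_designC`**: on the record of a genuine
  `v ∈ {0,1}^ℓ` and seed `z ∈ {0,1}^{Q²}`, `Q = pᵗ ≥ n'`, the value is
  `List.ofFn (z ∘ designC 𝔭 ht n' ℓ hN v)`.

Each function is obtained from a `CodeFP` statement (`Classical.choose`), is in `FP`, and its value
is specified on all records of the layout. All statements are proved; no named facts.

## References

* M. Carmosino, R. Impagliazzo, V. Kabanets, A. Kolokolova, *Learning algorithms from natural
  proofs*, CCC 2016, LIPIcs 50, §3.1, Thm. 3.6 [CarmosinoImpagliazzoKabanetsKolokolova2016].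
* S. Arora, B. Barak, *Computational Complexity: A Modern Approach*, CUP 2009, §1.3 [AroraBarak2009].
-/

namespace Literature.Computability.Learning

namespace Modp

open _root_.Computability Polynomial Literature.Computability.Complexity Literature.Computability.Complexity.CodeFP
  Literature.Computability.Complexity.Brick Literature.Computability.MetaComplexity
  Literature.Computability.MetaComplexity.GFDesign

/-- **The fixed prime of the learner.** The learner of CIKK Thm. 5.1 for `AC⁰[p]` is a different
algorithm for each prime `p` (`p` is hard-wired, not an input); the machine layer threads `p`
through its string functions as this typeclass parameter, instantiated once in the final theorem
(`⟨p, hp⟩`). [folklore] -/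
class PrimeP where
  /-- the prime -/
  p : ℕ
  /-- primality -/
  prime : p.Prime

/-- The prime of the learner, `𝔭`. [folklore] -/
scoped notation "𝔭" => PrimeP.p

/-- `𝔭` is prime (instance form). [folklore] -/
instance PrimeP.fact [P : PrimeP] : Fact (𝔭).Prime := ⟨P.prime⟩

variable [P : PrimeP]

/-- The code of the design records: `((pad, (Q, (ℓ, (vbits, zbits)))), m)`. [folklore] -/
abbrev recE : (List Bool × ℕ × ℕ × List Bool × List Bool) × ℕ → List Bool :=
  pairE (pairE strE (pairE unE (pairE unE (pairE strE strE)))) unE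

omit P in
/-- The design records are the codes of tuples. [folklore] -/
theorem recE_apply (pad : List Bool) (Q ℓ : ℕ) (vbits zbits : List Bool) (m : ℕ) :
    recE ((pad, (Q, (ℓ, (vbits, zbits)))), m) = boolPair (designCtx pad Q ℓ vbits zbits) (ones m) := by
  simp [recE, designCtx, unE_eq_ones]

omit P in
/-- Unary multiplication. [folklore] -/
theorem unMul : CodeFP (pairE unE unE) unE (fun q => q.1 * q.2) :=
  ⟨HashBricks.umulFn, HashBricks.umulFn_mem_FP, fun q => by
    rw [pairE_apply, unE_eq_ones, unE_eq_ones, HashBricks.umulFn_boolPair, unE_eq_ones]⟩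

/-! ### The column value -/

/-- The column value on design records, as a `CodeFP` statement. [folklore] -/
theorem col_spec : CodeFP recE natE (fun a => colValL 𝔭 a.1.2.1 a.1.2.2.1 a.1.2.2.2.1 a.2) := by
  have hQ : CodeFP recE unE (fun a => a.1.2.1) := (fst _ _).snd'.fst'
  have hℓ : CodeFP recE unE (fun a => a.1.2.2.1) := (fst _ _).snd'.snd'.fst'
  have hv : CodeFP recE strE (fun a => a.1.2.2.2.1) := (fst _ _).snd'.snd'.snd'.fst'
  have hτ : CodeFP recE natE (fun a => a.2) := (natOfUn.comp (snd _ _)).congr fun _ => rfl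
  exact (codeFP_colValL.comp (hQ.pair (hℓ.pair (hv.pair hτ)))).congr fun _ => rfl

/-- **The column function** `⟨X, 1^τ⟩ ↦ bin (colValL 𝔭 Q ℓ vbits τ)`. [cite: CarmosinoImpagliazzoKabanetsKolokolova2016, §3.1] -/
noncomputable def colFn : List Bool → List Bool := Classical.choose col_spec

/-- `colFn ∈ FP`. [folklore] -/
theorem colFn_mem_FP : colFn ∈ FP := (Classical.choose_spec col_spec).1

/-- **Value of `colFn`** on every record. [folklore] -/
theorem colFn_apply (pad : List Bool) (Q ℓ : ℕ) (vbits zbits : List Bool) (τ : ℕ) :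
    colFn (boolPair (designCtx pad Q ℓ vbits zbits) (ones τ)) = encodeNat (colValL 𝔭 Q ℓ vbits τ) := by
  rw [← recE_apply]; exact (Classical.choose_spec col_spec).2 ((pad, (Q, (ℓ, (vbits, zbits)))), τ)

/-! ### The position -/

/-- The position `colValL + Q·τ` in unary (the column value is capped at `Q`, an inactive cap by
`colValL_le`). [folklore] -/
theorem pos_spec : CodeFP recE unE (fun a => colValL 𝔭 a.1.2.1 a.1.2.2.1 a.1.2.2.2.1 a.2 + a.1.2.1 * a.2) := by
  have hQ : CodeFP recE unE (fun a => a.1.2.1) := (fst _ _).snd'.fst'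
  have hτ : CodeFP recE unE (fun a => a.2) := snd _ _
  have hcol : CodeFP recE unE (fun a => min (colValL 𝔭 a.1.2.1 a.1.2.2.1 a.1.2.2.2.1 a.2) a.1.2.1) :=
    unOfNatMin.comp (hQ.pair col_spec)
  exact (unAdd.comp (hcol.pair (unMul.comp (hQ.pair hτ)))).congr fun a => by
    rw [min_eq_left (colValL_le 𝔭 _ _ _ _)]

/-- **The position function** `⟨X, 1^τ⟩ ↦ 1^{colValL … + Q·τ}`. [cite: CarmosinoImpagliazzoKabanetsKolokolova2016, §3.1] -/
noncomputable def posFn : List Bool → List Bool := Classical.choose pos_spec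

/-- `posFn ∈ FP`. [folklore] -/
theorem posFn_mem_FP : posFn ∈ FP := (Classical.choose_spec pos_spec).1

/-- **Value of `posFn`** on every record. [folklore] -/
theorem posFn_apply (pad : List Bool) (Q ℓ : ℕ) (vbits zbits : List Bool) (τ : ℕ) :
    posFn (boolPair (designCtx pad Q ℓ vbits zbits) (ones τ)) = ones (colValL 𝔭 Q ℓ vbits τ + Q * τ) := by
  rw [← recE_apply, ← unE_eq_ones]; exact (Classical.choose_spec pos_spec).2 ((pad, (Q, (ℓ, (vbits, zbits)))), τ)

/-! ### The restriction `z|_{S_v}` -/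

omit P in
/-- `List.ofFn` over `Fin n` is a `map` over `List.range n`. [folklore] -/
private theorem ofFn_eq_map_range {α : Type} {n : ℕ} (g : ℕ → α) : (List.ofFn fun j : Fin n => g j) = (List.range n).map g := by
  refine List.ext_getElem (by simp) fun i h₁ h₂ => ?_
  simp

omit P in
/-- Reading bit `j` of a raw string by cutting. [folklore] -/
private theorem decide_drop_take_eq (s : List Bool) (j : ℕ) : decide ((s.drop j).take 1 = [true]) = s.getD j false := by
  by_cases h : j < s.length
  · rw [List.take_one_drop_eq_of_lt_length h, List.getD_eq_getElem _ _ h]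
    cases hb : s[j] <;> simp [hb]
  · push Not at h
    rw [List.drop_of_length_le h, List.take_nil, List.getD_eq_default _ _ h]
    simp

omit P in
/-- A raw list of bits read as the string of those bits. [folklore] -/
theorem strOfBits : CodeFP (rawE bitE) strE (fun l : List Bool => l) := by
  have hsing : CodeFP bitE strE (fun b : Bool => [b]) := transparent fun _ => rfl
  have hstep : CodeFP (pairE bitE strE) strE (fun t => t.2 ++ [t.1]) :=
    strAppend.comp ((snd _ _).pair (hsing.comp (fst _ _)))
  have h := foldl₀ (α := Bool) (β := List Bool) (eα := bitE) (eβ := strE) (step := fun b acc => acc ++ [b]) (b₀ := [])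
    hstep X (fun l₁ l₂ => by
      rw [foldl_append_singleton, List.nil_append, List.map_id', eval_X]
      exact le_trans (by simp) (length_le_length_rawE bitE (l₁ ++ l₂)))
  exact h.congr fun l => by rw [foldl_append_singleton, List.nil_append, List.map_id']

/-- The restriction on design records, as a `CodeFP` statement: the list of the bits
`zbits[colValL … τ + Q·τ]`, `τ < n'`. [folklore] -/
theorem restrict_spec : CodeFP recE strE
    (fun a => List.ofFn fun τ : Fin a.2 => a.1.2.2.2.2.getD (colValL 𝔭 a.1.2.1 a.1.2.2.1 a.1.2.2.2.1 τ + a.1.2.1 * τ) false) := by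
  -- context: the record; item `τ` (binary), capped at `n'` to a unary numeral
  have hrec : CodeFP (pairE recE natE) recE (fun y => y.1) := fst _ _
  have hτ : CodeFP (pairE recE natE) unE (fun y => min y.2 y.1.2) := unOfNatMin.comp (hrec.snd'.pair (snd _ _))
  have hpos : CodeFP (pairE recE natE) unE
      (fun y => colValL 𝔭 y.1.1.2.1 y.1.1.2.2.1 y.1.1.2.2.2.1 (min y.2 y.1.2) + y.1.1.2.1 * min y.2 y.1.2) :=
    (pos_spec.comp (hrec.fst'.pair hτ)).congr fun _ => rfl
  have hz : CodeFP (pairE recE natE) strE (fun y => y.1.1.2.2.2.2) := hrec.fst'.snd'.snd'.snd'.snd'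
  have hcut : CodeFP (pairE recE natE) strE
      (fun y => (y.1.1.2.2.2.2.drop (colValL 𝔭 y.1.1.2.1 y.1.1.2.2.1 y.1.1.2.2.2.1 (min y.2 y.1.2) + y.1.1.2.1 * min y.2 y.1.2)).take 1) :=
    (strTake.comp ((const _ 1).pair (strDrop.comp (hpos.pair hz)))).congr fun _ => rfl
  have hbit : CodeFP (pairE recE natE) bitE
      (fun y => decide (((y.1.1.2.2.2.2.drop (colValL 𝔭 y.1.1.2.1 y.1.1.2.2.1 y.1.1.2.2.2.1 (min y.2 y.1.2) + y.1.1.2.1 * min y.2 y.1.2))).take 1 = [true])) :=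
    ((CodeFP.eq (eα := strE) (fun _ _ h => h)).comp (hcut.pair (const _ [true]))).congr fun _ => rfl
  have hm := strOfBits.comp ((map hbit).comp ((CodeFP.id recE).pair (urange.comp (snd _ _))))
  refine hm.congr fun a => ?_
  obtain ⟨⟨pad, Q, ℓ, vbits, zbits⟩, n'⟩ := a
  dsimp only [id_eq]
  rw [ofFn_eq_map_range (fun τ => zbits.getD (colValL 𝔭 Q ℓ vbits τ + Q * τ) false)]
  refine List.map_congr_left fun τ hτ => ?_
  rw [List.mem_range] at hτ
  have hmin : min τ n' = τ := min_eq_left hτ.le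
  simp only [hmin]
  exact decide_drop_take_eq _ _

/-- **The restriction function** `⟨X, 1^{n'}⟩ ↦` the `n'` bits `zbits[pos(v, τ)]`.
[cite: CarmosinoImpagliazzoKabanetsKolokolova2016, §3.1 ("`MX_NW(i, z) = z|_{S_i}`")] -/
noncomputable def restrictFn : List Bool → List Bool := Classical.choose restrict_spec

/-- `restrictFn ∈ FP`. [folklore] -/
theorem restrictFn_mem_FP : restrictFn ∈ FP := (Classical.choose_spec restrict_spec).1

/-- **Value of `restrictFn`** on every record. [folklore] -/
theorem restrictFn_apply (pad : List Bool) (Q ℓ : ℕ) (vbits zbits : List Bool) (n' : ℕ) :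
    restrictFn (boolPair (designCtx pad Q ℓ vbits zbits) (ones n')) =
      List.ofFn fun τ : Fin n' => zbits.getD (colValL 𝔭 Q ℓ vbits τ + Q * τ) false := by
  rw [← recE_apply]; exact (Classical.choose_spec restrict_spec).2 ((pad, (Q, (ℓ, (vbits, zbits)))), n')

/-- **`restrictFn` computes `z|_{S_v}` for the concrete design**: on the record of a bit string `v`
and a seed `z ∈ {0,1}^{Q²}`, `Q = pᵗ ≥ n'`, it returns `List.ofFn (z ∘ designC 𝔭 ht n' ℓ hN v)`.
[cite: CarmosinoImpagliazzoKabanetsKolokolova2016, §3.1, Thm. 3.6] -/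
theorem restrictFn_eq_ofFn_designC (pad : List Bool) {t : ℕ} (ht : t ≠ 0) (n' ℓ : ℕ) (hN : n' ≤ 𝔭 ^ t)
    (v : Fin ℓ → Bool) (z : Fin (𝔭 ^ t * 𝔭 ^ t) → Bool) :
    restrictFn (boolPair (designCtx pad (𝔭 ^ t) ℓ (List.ofFn v) (List.ofFn z)) (ones n')) =
      List.ofFn (z ∘ designC 𝔭 ht n' ℓ hN v) := by
  rw [restrictFn_apply]
  congr 1
  funext τ
  have hval := designC_val_colValL 𝔭 ht hN v τ
  have hlt : colValL 𝔭 (𝔭 ^ t) ℓ (List.ofFn v) τ + 𝔭 ^ t * τ < 𝔭 ^ t * 𝔭 ^ t := by rw [← hval]; exact Fin.isLt _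
  rw [List.getD_eq_getElem _ _ (by simpa using hlt), List.getElem_ofFn, Function.comp_apply]
  congr 1
  exact Fin.ext hval.symm

end Modp

end Literature.Computability.Learning
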